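import Summits.CriticalPhenomena.CardyFormulaZ2.Theorems.CardyBoundaryCoulombGasRectilinearCardyClosureDefs
import Summits.CriticalPhenomena.CardyFormulaZ2.Theorems.CardyBoundaryCoulombGasRectilinearCardyStubClosureOneArm
import Summits.CriticalPhenomena.CardyFormulaZ2.Theorems.CardyBoundaryCoulombGasAssembly
import Summits.CriticalPhenomena.CardyFormulaZ2.Theorems.RectilinearCardy.Negative.RectilinearCardyReductions
import HarnessLib

/-!
# Stub F `stub_closureToConjunct` of line `excursion-kernel-covariance`: closure Cardy on rectilinear
# conformal rectangles implies `CardyFormulaZ2`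
# (crux `RectilinearCardy`, stmt-CriticalPhenomena-5660, route `CardyBoundaryCoulombGas`)

Port of the landed assembly `RectilinearApproximation.cardyFormulaZ2_of_rectilinearCardy`
(`Theorems/CardyBoundaryCoulombGasAssembly.lean`: Bollobás–Riordan's construction-free sandwich,
Ch. 7 Claim 19 + remark p. 195, for the G02 discretisation of bond-`ℤ²`) with the MESH crossing
probability `bondDomainCrossingProb P` of the two rectilinear approximants `P` replaced by the CLOSURE
crossing probability `closureCrossingProb P δ = P_{1/2}[rowArc ↔ rowTail (mark 2) by an open path of V_δ]`
(`V_δ = closureFinset P δ = {v : δ v ∈ Ω̄}`, rows attributed by Smirnov's closest-arc rule), whose limit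
`F(η_P)` is the hypothesis. The assembly uses the approximants ONLY through that limit and through two
deterministic inclusions of events at each small mesh, which are re-proved here for the closure event:

* `ctc_closureCrossing_subset_of_lower` — LOWER: for `ω ⊆ E(ℤ²)` (a.s., `ae_subset_edgeSet`), an open
  path of `V_δ(P)` from `rowArc P δ` to `rowTail P δ (mark 2)`, `P` the rectilinear approximant of the
  lower quad `Q` of `R`, is fed to stub A `stub_discreteCrossing_of_pathIn R` with site set
  `S = V_δ(P)` (its mesh points lie in `Ω̄_P ⊆ cthickening r Q`), start within `δ` of `P.arc 0`
  (`coa_infDist_arc_le_of_mem_rowArc`) hence in `cthickening r (Q.arc 0)`, end within `δ` of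
  `P.arc 2 = tailArc P (mark 2)` hence in `cthickening r (Q.arc 2)`, and the path
  `PathIn (openGraph ω ⊓ zdGraph 2) S u v` extracted from `openConnIn` (`DCT16.pathIn_of_mem_openConnIn`,
  `openGraph_inf_eq`, `ω ⊆ E(ℤ²)`); so it IS a G02 crossing of `R_δ`;
* `ctc_closureCrossing_subset_plate` — UPPER: the same event for the approximant of the upper quad `N`
  is an open plate path of `N` with room `r/2` (monotonicity of `openCrossing` in its three sets);
* `stub_closureToConjunct` — the assembly, verbatim up to `measure_mono_ae` on the lower side.

References: B. Bollobás, O. Riordan, *Percolation* (2006), Ch. 7; S. Smirnov (2001) §2.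
-/

noncomputable section

open Set Filter Topology MeasureTheory Metric
open Literature.Probability.RandomPlanarGeometry
open Literature.Probability.Percolation (bondDomainCrossingProb bondDomainCrossingProb_eq_measureReal
  discreteCrossingProb discreteCrossing half bondPercolation openCrossing openConnIn openCrossing_mono
  ae_subset_edgeSet BondConfig openGraph PathIn openGraph_inf_eq)
open Literature.Probability.LatticeModels (Site meshPoint meshDomain meshBoundary discreteArc
  meshDomain_finite meshVertices meshVertices_finite zdGraph)
open Summit.CriticalPhenomena.CardyFormulaZ2.Theorems.RectilinearCardy.Negative (IsRectilinear)
open Summit.CriticalPhenomena.CardyFormulaZ2.Theorems (exists_rectilinear_close)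
open Summit.CriticalPhenomena.CardyFormulaZ2.Theorems.RectilinearApproximation
  (carrier_subset_cthickening_of_dist_boundary_le arc_subset_cthickening_of_dist_boundary_le
    bond_le_one_sub_real_openCrossing)
open Summit.CriticalPhenomena.CardyFormulaZ2.Cruxes.LoopsToCrossings.OracleSandwich
  (stub_discreteCrossing_of_pathIn stub_not_discreteCrossing_of_dualPathIn stub_cardyContinuity
    stub_comparisonGeometry stub_cyclicFlip)
open UpperHalfPlane (upperHalfPlaneSet)

namespace Summit.CriticalPhenomena.CardyFormulaZ2.Cruxes.RectilinearCardy.ExcursionKernelCovariance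

/-! ### Where the closure event lives -/

/-- A mesh point within `δ` of an arc of `P` lies in the closed `(ρ + δ)`-fattening of the corresponding
arc of `Q`, when `P` has the marks of `Q` and a pointwise `ρ`-close boundary loop. [folklore] -/
theorem ctc_mem_cthickening_arc (Q P : ConformalRectangle) {ρ δ : ℝ}
    (hclose : ∀ u, dist (P.boundary u) (Q.boundary u) ≤ ρ) (hmark : ∀ i, P.mark i = Q.mark i)
    (hρ : 0 ≤ ρ) (hδ : 0 ≤ δ) (i : Fin 4) {z : ℂ} (hz : infDist z (P.arc i) ≤ δ) :
    z ∈ cthickening (ρ + δ) (Q.arc i) := by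
  -- adapted from `harc` in `RectilinearApproximation.discreteCrossing_subset_of_lower`
  obtain ⟨p, hp, hpd⟩ := (P.isCompact_arc i).exists_infDist_eq_dist ⟨_, P.pt_mem_arc_self i⟩ z
  have hp' : p ∈ cthickening ρ (Q.arc i) :=
    arc_subset_cthickening_of_dist_boundary_le Q P hclose hmark i hp
  have := mem_cthickening_of_dist_le _ _ δ _ hp' (by rw [← hpd]; exact hz)
  rw [add_comm]
  exact cthickening_cthickening_subset hδ hρ _ this

/-- The mesh points of `V_δ(P)` lie in `Ω̄_P`, hence in the closed `ρ`-fattening of `Q` when the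
boundary loop of `P` is pointwise `ρ`-close to that of `Q`. [folklore] -/
theorem ctc_meshPoint_mem_cthickening_of_mem_closureFinset (Q P : ConformalRectangle) {ρ δ : ℝ}
    (hclose : ∀ u, dist (P.boundary u) (Q.boundary u) ≤ ρ) (hδ : 0 < δ) {x : Site 2}
    (hx : x ∈ closureFinset P δ) : meshPoint δ x ∈ cthickening ρ Q.carrier :=
  closure_minimal (carrier_subset_cthickening_of_dist_boundary_le Q.toJordanDomain P.toJordanDomain
    hclose) isClosed_cthickening ((mem_closureFinset_iff P hδ).1 hx)

/-- A vertex of the target row `rowTail P δ (mark 2)` has its mesh point within `δ` of the arc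
`(cd) = P.arc 2 = tailArc P (mark 2)`. [folklore] -/
theorem ctc_infDist_arc_two_le_of_mem_rowTail (P : ConformalRectangle) {δ : ℝ} (hδ : 0 < δ)
    {v : Site 2} (hv : v ∈ rowTail P δ (P.mark 2)) : infDist (meshPoint δ v) (P.arc 2) ≤ δ := by
  obtain ⟨hrow, h⟩ := (mem_rowTail_iff P).1 hv
  rw [← arc_two_eq_tailArc] at h
  exact coa_infDist_le_of_attr_row P hδ hrow h

/-- For a lattice configuration `ω ⊆ E(ℤ²)`, an open connection inside `S` is an open `ℤ²`-path
inside `S`. [folklore] -/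
theorem ctc_pathIn_of_mem_openConnIn {S : Set (Site 2)} {ω : BondConfig (Site 2)}
    (hω : ω ⊆ (zdGraph 2).edgeSet) {u v : Site 2} (h : ω ∈ openConnIn S u v) :
    PathIn (openGraph ω ⊓ zdGraph 2) S u v := by
  have h1 := Literature.Probability.Percolation.DCT16.pathIn_of_mem_openConnIn h
  rw [openGraph_inf_eq, Set.inter_eq_left.2 hω]
  exact h1

/-! ### The two deterministic inclusions for the closure event -/

/-- **Lower inclusion, closure version.** Let `R` be a conformal rectangle with stub-A constants
`δ₀, t₀`, `Q` a lower comparison quad with room `r` and lateral margin `m`, and `P` a conformal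
rectangle with the marks of `Q` and a boundary loop pointwise `ρ`-close to that of `Q`, `ρ ≤ r/2`.
For `0 < δ < min δ₀ m`, `δ ≤ r/2` and a lattice configuration `ω ⊆ E(ℤ²)`: if `rowArc P δ` is
joined to `rowTail P δ (mark 2)` by an `ω`-open path of `V_δ(P)`, then `ω` is a G02 crossing of
`R_δ`. [cite: BollobasRiordan2006, Ch. 7 Claim 19 p. 192] -/
theorem ctc_closureCrossing_subset_of_lower (R Q P : ConformalRectangle) {δ₀ t₀ r m ρ δ : ℝ}
    (hAfor : ∀ δ t : ℝ, 0 < δ → δ < δ₀ → 0 ≤ t → t ≤ t₀ →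
        ∀ (ω : BondConfig (Site 2)) (S : Set (Site 2)) (u v : Site 2),
          (∀ x ∈ S, meshPoint δ x ∉ R.carrier →
            infDist (meshPoint δ x) (R.arc 0) ≤ t ∨ infDist (meshPoint δ x) (R.arc 2) ≤ t) →
          (∀ x ∈ S, meshPoint δ x ∈ R.carrier →
            δ < infDist (meshPoint δ x) (R.arc 1) ∧ δ < infDist (meshPoint δ x) (R.arc 3)) →
          meshPoint δ u ∉ R.carrier → infDist (meshPoint δ u) (R.arc 0) ≤ t →
          meshPoint δ v ∉ R.carrier → infDist (meshPoint δ v) (R.arc 2) ≤ t →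
          PathIn (openGraph ω ⊓ zdGraph 2) S u v →
          ω ∈ discreteCrossing R.carrier δ (R.arc 0) (R.arc 2))
    (hL1 : ∀ z ∈ cthickening r Q.carrier, z ∉ R.carrier →
      infDist z (R.arc 0) ≤ t₀ ∨ infDist z (R.arc 2) ≤ t₀)
    (hL2 : ∀ z ∈ cthickening r Q.carrier, z ∈ R.carrier →
      m ≤ infDist z (R.arc 1) ∧ m ≤ infDist z (R.arc 3))
    (hL3 : ∀ z ∈ cthickening r (Q.arc 0), z ∉ R.carrier ∧ infDist z (R.arc 0) ≤ t₀)
    (hL4 : ∀ z ∈ cthickening r (Q.arc 2), z ∉ R.carrier ∧ infDist z (R.arc 2) ≤ t₀)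
    (hclose : ∀ u, dist (P.boundary u) (Q.boundary u) ≤ ρ) (hmark : ∀ i, P.mark i = Q.mark i)
    (hρ : 0 ≤ ρ) (hρr : ρ ≤ r / 2) (hδ : 0 < δ) (hδ₀ : δ < δ₀) (hδm : δ < m) (hδr : δ ≤ r / 2)
    (ht₀ : 0 ≤ t₀) {ω : BondConfig (Site 2)} (hω : ω ⊆ (zdGraph 2).edgeSet)
    (hmem : ω ∈ openCrossing (↑(closureFinset P δ) : Set (Site 2)) ↑(rowArc P δ)
      ↑(rowTail P δ (P.mark 2))) :
    ω ∈ discreteCrossing R.carrier δ (R.arc 0) (R.arc 2) := by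
  -- adapted from `RectilinearApproximation.discreteCrossing_subset_of_lower`
  obtain ⟨a, ha, b, hb, hab⟩ := hmem
  have hS : ∀ x ∈ (↑(closureFinset P δ) : Set (Site 2)), meshPoint δ x ∈ cthickening r Q.carrier :=
    fun x hx => cthickening_mono (by linarith) _
      (ctc_meshPoint_mem_cthickening_of_mem_closureFinset Q P hclose hδ (Finset.mem_coe.1 hx))
  have harc : ∀ (i : Fin 4) {c : Site 2}, infDist (meshPoint δ c) (P.arc i) ≤ δ →
      meshPoint δ c ∈ cthickening r (Q.arc i) := fun i c hc =>
    cthickening_mono (by linarith) _ (ctc_mem_cthickening_arc Q P hclose hmark hρ hδ.le i hc)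
  have ha' := harc 0 (coa_infDist_arc_le_of_mem_rowArc P hδ (Finset.mem_coe.1 ha))
  have hb' := harc 2 (ctc_infDist_arc_two_le_of_mem_rowTail P hδ (Finset.mem_coe.1 hb))
  refine hAfor δ t₀ hδ hδ₀ ht₀ le_rfl ω _ a b (fun x hx hxR => hL1 _ (hS x hx) hxR)
    (fun x hx hxR => ?_) (hL3 _ ha').1 (hL3 _ ha').2 (hL4 _ hb').1 (hL4 _ hb').2
    (ctc_pathIn_of_mem_openConnIn hω hab)
  have := hL2 _ (hS x hx) hxR
  exact ⟨hδm.trans_le this.1, hδm.trans_le this.2⟩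

/-- **Upper inclusion, closure version.** If `P` has the marks of `N` and a boundary loop pointwise
`ρ`-close to that of `N`, `ρ ≤ r/4`, then for `0 < δ ≤ r/4` an open path of `V_δ(P)` from
`rowArc P δ` to `rowTail P δ (mark 2)` is an open plate path of `N` with room `r/2`: all its sites
are in the closed `r/2`-fattening of `N`, it starts in that of `N.arc 0` and ends in that of
`N.arc 2`. [cite: BollobasRiordan2006, Ch. 7 remark p. 195] -/
theorem ctc_closureCrossing_subset_plate (N P : ConformalRectangle) {r ρ δ : ℝ}
    (hclose : ∀ u, dist (P.boundary u) (N.boundary u) ≤ ρ) (hmark : ∀ i, P.mark i = N.mark i)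
    (hρ : 0 ≤ ρ) (hρr : ρ ≤ r / 4) (hδ : 0 < δ) (hδr : δ ≤ r / 4) :
    openCrossing (↑(closureFinset P δ) : Set (Site 2)) ↑(rowArc P δ) ↑(rowTail P δ (P.mark 2)) ⊆
      openCrossing {x : Site 2 | meshPoint δ x ∈ cthickening (r / 2) N.carrier}
        {x | meshPoint δ x ∈ cthickening (r / 2) (N.arc 0)}
        {x | meshPoint δ x ∈ cthickening (r / 2) (N.arc 2)} := by
  -- adapted from `RectilinearApproximation.discreteCrossing_subset_plate`
  have harc : ∀ (i : Fin 4) {c : Site 2}, infDist (meshPoint δ c) (P.arc i) ≤ δ →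
      meshPoint δ c ∈ cthickening (r / 2) (N.arc i) := fun i c hc =>
    cthickening_mono (by linarith) _ (ctc_mem_cthickening_arc N P hclose hmark hρ hδ.le i hc)
  refine openCrossing_mono (fun x hx => ?_) (fun a ha => ?_) (fun b hb => ?_)
  · exact cthickening_mono (by linarith) _
      (ctc_meshPoint_mem_cthickening_of_mem_closureFinset N P hclose hδ (Finset.mem_coe.1 hx))
  · exact harc 0 (coa_infDist_arc_le_of_mem_rowArc P hδ (Finset.mem_coe.1 ha))
  · exact harc 2 (ctc_infDist_arc_two_le_of_mem_rowTail P hδ (Finset.mem_coe.1 hb))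

/-! ### The assembly -/

/-- **Stub F of line excursion-kernel-covariance (crux RectilinearCardy, stmt-CriticalPhenomena-5660)** (registered signature, verbatim).
Cardy's formula for the CLOSURE crossing probability of every rectilinear conformal rectangle implies
Cardy's formula (G02 mesh discretisation) for every conformal rectangle: Bollobás–Riordan's
construction-free sandwich, verbatim the landed `RectilinearApproximation.cardyFormulaZ2_of_rectilinearCardy`
with the two event inclusions replaced by their closure versions
(`ctc_closureCrossing_subset_of_lower`, a.s. through `ae_subset_edgeSet`; `ctc_closureCrossing_subset_plate`).
[cite: BollobasRiordan2006, Ch. 7 Lemma 14 p. 184, Claims 19–20 p. 192, remark p. 195] -/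
theorem stub_closureToConjunct :
    (∀ R : ConformalRectangle, IsRectilinear R →
        R.HasCrossingLimit (closureCrossingProb R) cardyFunction) →
      _root_.CardyFormulaZ2 := by
  -- adapted from `RectilinearApproximation.cardyFormulaZ2_of_rectilinearCardy`
  intro hRC R φ x hux
  set L : ℝ := cardyFunction (crossRatio x) with hL
  -- the cyclically re-marked copy and the two continuity moduli
  obtain ⟨R₂, _hcar, hbd, hmk, hflip⟩ := stub_cyclicFlip R
  obtain ⟨φ₂, x₂, hux₂⟩ := MarkedDomain.exists_isUniformizing_holds R₂
  -- lower bound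
  have hlow : ∀ e : ℝ, 0 < e → ∀ᶠ δ : ℝ in 𝓝[>] 0, L - e < bondDomainCrossingProb R δ := by
    intro e he
    obtain ⟨ε₁, hε₁, h1⟩ := stub_cardyContinuity R φ x hux (e / 3) (by positivity)
    obtain ⟨m, hm, hgeo⟩ := stub_comparisonGeometry R (ε₁ / 2) (by positivity)
    obtain ⟨δ₀, hδ₀, t₀, ht₀, hAfor⟩ := stub_discreteCrossing_of_pathIn R
    obtain ⟨⟨Q, r, hr, hQb, hQm, hL1, hL2, hL3, hL4⟩, -⟩ := hgeo t₀ ht₀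
    obtain ⟨P, hPmark, hPS, hPclose⟩ :=
      exists_rectilinear_close Q (ε := min (ε₁ / 2) (r / 2)) (lt_min (by positivity) (by positivity))
    obtain ⟨ψ, y, hψ⟩ := MarkedDomain.exists_isUniformizing_holds P
    have hF : |cardyFunction (crossRatio y) - L| ≤ e / 3 := by
      refine h1 P (fun u => ?_) (fun i => ?_) ψ y hψ
      · calc dist (P.boundary u) (R.boundary u)
            ≤ dist (P.boundary u) (Q.boundary u) + dist (Q.boundary u) (R.boundary u) :=
              dist_triangle _ _ _
          _ ≤ min (ε₁ / 2) (r / 2) + ε₁ / 2 := add_le_add (hPclose u) (hQb u)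
          _ ≤ ε₁ := by have := min_le_left (ε₁ / 2) (r / 2); linarith
      · rw [hPmark i]; exact (hQm i).trans (by linarith)
    have hPlim : Tendsto (closureCrossingProb P) (𝓝[>] 0) (𝓝 (cardyFunction (crossRatio y))) :=
      hRC P hPS ψ y hψ
    have hev1 : ∀ᶠ δ : ℝ in 𝓝[>] 0, cardyFunction (crossRatio y) - e / 3 < closureCrossingProb P δ :=
      hPlim.eventually (lt_mem_nhds (by linarith))
    have hev2 : ∀ᶠ δ : ℝ in 𝓝[>] 0, δ ∈ Ioo 0 (min δ₀ (min m (r / 2))) :=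
      Ioo_mem_nhdsGT (lt_min hδ₀ (lt_min hm (by positivity)))
    filter_upwards [hev1, hev2] with δ hδ1 hδ2
    have hδ₀' : δ < δ₀ := hδ2.2.trans_le (min_le_left _ _)
    have hδm : δ < m := hδ2.2.trans_le ((min_le_right _ _).trans (min_le_left _ _))
    have hδr : δ < r / 2 := hδ2.2.trans_le ((min_le_right _ _).trans (min_le_right _ _))
    have hle : closureCrossingProb P δ ≤ bondDomainCrossingProb R δ := by
      rw [closureCrossingProb_eq, bondDomainCrossingProb_eq_measureReal]
      simp only [measureReal_def]
      refine ENNReal.toReal_mono (measure_ne_top _ _) (measure_mono_ae ?_)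
      filter_upwards [ae_subset_edgeSet (zdGraph 2) half] with ω hω hmem
      exact ctc_closureCrossing_subset_of_lower R Q P hAfor hL1 hL2 hL3 hL4 hPclose hPmark
        (le_min (by positivity) (by positivity)) (min_le_right _ _) hδ2.1 hδ₀' hδm hδr.le ht₀.le
        hω hmem
    have hF' := (abs_sub_le_iff.1 hF).2
    linarith
  -- upper bound
  have hup : ∀ e : ℝ, 0 < e → ∀ᶠ δ : ℝ in 𝓝[>] 0, bondDomainCrossingProb R δ < L + e := by
    intro e he
    obtain ⟨ε₂, hε₂, h2⟩ := stub_cardyContinuity R₂ φ₂ x₂ hux₂ (e / 3) (by positivity)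
    obtain ⟨m, hm, hgeo⟩ := stub_comparisonGeometry R (ε₂ / 2) (by positivity)
    obtain ⟨δ₀, hδ₀, t₀, ht₀, hBfor⟩ := stub_not_discreteCrossing_of_dualPathIn R m hm
    obtain ⟨-, ⟨N, r, hr, hNb, hNm, hU1, hU2, hU3, hU4, hU5⟩⟩ := hgeo t₀ ht₀
    obtain ⟨P, hPmark, hPS, hPclose⟩ :=
      exists_rectilinear_close N (ε := min (ε₂ / 2) (r / 4)) (lt_min (by positivity) (by positivity))
    obtain ⟨ψ, y, hψ⟩ := MarkedDomain.exists_isUniformizing_holds P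
    have hF : |cardyFunction (crossRatio y) - (1 - L)| ≤ e / 3 := by
      rw [← hflip φ x φ₂ x₂ hux hux₂]
      refine h2 P (fun u => ?_) (fun i => ?_) ψ y hψ
      · rw [hbd u]
        calc dist (P.boundary u) (R.boundary (u + R.mark 1))
            ≤ dist (P.boundary u) (N.boundary u) + dist (N.boundary u) (R.boundary (u + R.mark 1)) :=
              dist_triangle _ _ _
          _ ≤ min (ε₂ / 2) (r / 4) + ε₂ / 2 := add_le_add (hPclose u) (hNb u)
          _ ≤ ε₂ := by have := min_le_left (ε₂ / 2) (r / 4); linarith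
      · rw [hPmark i, hmk i]; exact (hNm i).trans (by linarith)
    have hPlim : Tendsto (closureCrossingProb P) (𝓝[>] 0) (𝓝 (cardyFunction (crossRatio y))) :=
      hRC P hPS ψ y hψ
    have hev1 : ∀ᶠ δ : ℝ in 𝓝[>] 0, cardyFunction (crossRatio y) - e / 3 < closureCrossingProb P δ :=
      hPlim.eventually (lt_mem_nhds (by linarith))
    have hev2 : ∀ᶠ δ : ℝ in 𝓝[>] 0, δ ∈ Ioo 0 (min δ₀ (min (m / 3) (r / 4))) :=
      Ioo_mem_nhdsGT (lt_min hδ₀ (lt_min (by positivity) (by positivity)))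
    filter_upwards [hev1, hev2] with δ hδ1 hδ2
    have hδ₀' : δ < δ₀ := hδ2.2.trans_le (min_le_left _ _)
    have hδm : δ < m / 3 := hδ2.2.trans_le ((min_le_right _ _).trans (min_le_left _ _))
    have hδr : δ < r / 4 := hδ2.2.trans_le ((min_le_right _ _).trans (min_le_right _ _))
    have hle := bond_le_one_sub_real_openCrossing R hBfor hU1 hU2 hU3 hU4 hU5 hδ2.1 hδ₀'
      (by linarith) (by linarith) ht₀.le le_rfl
    have hincl := ctc_closureCrossing_subset_plate N P hPclose hPmark
      (le_min (by positivity) (by positivity)) (min_le_right _ _) hδ2.1 hδr.le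
    have hle' : closureCrossingProb P δ ≤ (bondPercolation (zdGraph 2) half).real
        (openCrossing {x : Site 2 | meshPoint δ x ∈ cthickening (r / 2) N.carrier}
          {x | meshPoint δ x ∈ cthickening (r / 2) (N.arc 0)}
          {x | meshPoint δ x ∈ cthickening (r / 2) (N.arc 2)}) := by
      rw [closureCrossingProb_eq]
      exact measureReal_mono hincl
    have hF' := (abs_sub_le_iff.1 hF).2
    linarith
  rw [Metric.tendsto_nhds]
  intro e he
  filter_upwards [hlow e he, hup e he] with δ hδ1 hδ2
  rw [Real.dist_eq, abs_sub_lt_iff]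
  constructor <;> linarith

end Summit.CriticalPhenomena.CardyFormulaZ2.Cruxes.RectilinearCardy.ExcursionKernelCovariance

end
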